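import Summits.CriticalPhenomena.CardyFormulaZ2.Theorems.CardyMeckeFlipMeckeRigidityTranslationErgodic

/-!
# Dilations of quads and of quad-crossing configurations: the transport API

Route `Summits/CriticalPhenomena/CardyFormulaZ2/Theses/CardyMeckeFlip`, crux `MeckeRigidity`
(item stmt-CriticalPhenomena-14826), line `registered`, similarity-covariance package (lead c3).

The algebra of the plane dilations `w ↦ t • w` (`t ≠ 0`) acting on quads (`Quad.dilate`) and on the
Schramm–Smirnov space `ℋ_ℂ` (`QuadConfig.dilate = QuadConfig.mapHomeomorph (Homeomorph.mulLeft₀ t)`):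
pointwise formula, carriers and sides are images, composition `S_s ∘ S_t = S_{st}`, `S_1 = id`,
membership `Q ∈ S_t S ↔ S_{t⁻¹} Q ∈ S` (registered sub-goal `mem_quadConfig_dilate_iff`), continuity
and measurability of `S ↦ S_t S` (subbase check, as for isometries), preimages of crossing events.
-/

noncomputable section

open MeasureTheory Set Metric Filter Topology
open scoped ENNReal NNReal
open Literature.Probability.Percolation Literature.Probability.Percolation.QuadCrossing

namespace Summit.CriticalPhenomena.CardyFormulaZ2.Theorems.CardyMeckeFlip

/-! ### Quads -/

/-- `(S_t Q) z = t · Q z`. [folklore] -/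
@[simp] theorem quad_dilate_apply (t : ℝ) (ht : t ≠ 0) (Q : Quad (univ : Set ℂ))
    (z : unitInterval × unitInterval) : Q.dilate t ht z = (t : ℂ) * Q z := rfl

/-- The dilation of a quad is its image under the plane homeomorphism `w ↦ t w`. [folklore] -/
theorem quad_dilate_eq_mapHomeomorph (t : ℝ) (ht : t ≠ 0) (Q : Quad (univ : Set ℂ)) :
    Q.dilate t ht = Q.mapHomeomorph (Homeomorph.mulLeft₀ (t : ℂ) (Complex.ofReal_ne_zero.mpr ht)) :=
  Quad.ext fun _ => rfl

/-- `[S_t Q] = t · [Q]`. [folklore] -/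
theorem carrier_quad_dilate (t : ℝ) (ht : t ≠ 0) (Q : Quad (univ : Set ℂ)) :
    (Q.dilate t ht).carrier = (fun w : ℂ => (t : ℂ) * w) '' Q.carrier := by
  rw [quad_dilate_eq_mapHomeomorph, Quad.carrier_mapHomeomorph]
  rfl

/-- `∂ₖ(S_t Q) = t · ∂ₖ Q`. [folklore] -/
theorem side_quad_dilate (t : ℝ) (ht : t ≠ 0) (Q : Quad (univ : Set ℂ)) (k : Fin 4) :
    (Q.dilate t ht).side k = (fun w : ℂ => (t : ℂ) * w) '' Q.side k := by
  rw [quad_dilate_eq_mapHomeomorph, Quad.side_mapHomeomorph]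
  rfl

/-- `S_s (S_t Q) = S_{st} Q`. [folklore] -/
theorem quad_dilate_dilate (s t : ℝ) (hs : s ≠ 0) (ht : t ≠ 0) (Q : Quad (univ : Set ℂ)) :
    (Q.dilate t ht).dilate s hs = Q.dilate (s * t) (mul_ne_zero hs ht) := by
  ext z
  simp [mul_assoc]

/-- `S_1 Q = Q`. [folklore] -/
@[simp] theorem quad_dilate_one (Q : Quad (univ : Set ℂ)) : Q.dilate 1 one_ne_zero = Q := by
  ext z; simp

/-- Dilation with equal factors (and any proofs) agree. [folklore] -/
theorem quad_dilate_congr {s t : ℝ} (hs : s ≠ 0) (ht : t ≠ 0) (h : s = t) (Q : Quad (univ : Set ℂ)) :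
    Q.dilate s hs = Q.dilate t ht := by
  subst h; rfl

/-- `S_{t⁻¹} (S_t Q) = Q`. [folklore] -/
@[simp] theorem quad_dilate_inv_dilate (t : ℝ) (ht : t ≠ 0) (Q : Quad (univ : Set ℂ)) :
    (Q.dilate t ht).dilate t⁻¹ (inv_ne_zero ht) = Q := by
  rw [quad_dilate_dilate, quad_dilate_congr _ one_ne_zero (inv_mul_cancel₀ ht), quad_dilate_one]

/-- `S_t (S_{t⁻¹} Q) = Q`. [folklore] -/
@[simp] theorem quad_dilate_dilate_inv (t : ℝ) (ht : t ≠ 0) (Q : Quad (univ : Set ℂ)) :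
    (Q.dilate t⁻¹ (inv_ne_zero ht)).dilate t ht = Q := by
  rw [quad_dilate_dilate, quad_dilate_congr _ one_ne_zero (mul_inv_cancel₀ ht), quad_dilate_one]

/-! ### Configurations -/

/-- **Membership in a dilated configuration** (registered sub-goal `mem_quadConfig_dilate_iff` of item
stmt-CriticalPhenomena-14826): `Q ∈ S_t S ↔ S_{t⁻¹} Q ∈ S`. [folklore] -/
theorem mem_quadConfig_dilate_iff : ∀ (t : ℝ) (ht : t ≠ 0) (S : QuadConfig (Set.univ : Set ℂ)) (Q : Quad (Set.univ : Set ℂ)), Q ∈ QuadConfig.dilate t ht S ↔ Quad.dilate t⁻¹ (inv_ne_zero ht) Q ∈ S := by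
  intro t ht S Q
  rw [QuadConfig.dilate, QuadConfig.mem_mapHomeomorph]
  have h : Q.mapHomeomorph (Homeomorph.mulLeft₀ (t : ℂ) (Complex.ofReal_ne_zero.mpr ht)).symm =
      Q.dilate t⁻¹ (inv_ne_zero ht) := by
    ext z
    simp [Homeomorph.mulLeft₀, Complex.ofReal_inv]
  rw [h]

/-- `S_s (S_t S) = S_{st} S` on `ℋ_ℂ`. [folklore] -/
theorem quadConfig_dilate_dilate (s t : ℝ) (hs : s ≠ 0) (ht : t ≠ 0) (S : QuadConfig (univ : Set ℂ)) :
    QuadConfig.dilate s hs (QuadConfig.dilate t ht S) = QuadConfig.dilate (s * t) (mul_ne_zero hs ht) S := by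
  ext Q
  simp only [mem_quadConfig_dilate_iff, quad_dilate_dilate]
  rw [quad_dilate_congr _ (inv_ne_zero (mul_ne_zero hs ht)) (by rw [mul_inv_rev])]

/-- `S_1 = id` on `ℋ_ℂ`. [folklore] -/
@[simp] theorem quadConfig_dilate_one (S : QuadConfig (univ : Set ℂ)) : QuadConfig.dilate 1 one_ne_zero S = S := by
  ext Q
  rw [mem_quadConfig_dilate_iff, quad_dilate_congr _ one_ne_zero inv_one, quad_dilate_one]

/-- Dilation of configurations with equal factors (and any proofs) agree. [folklore] -/
theorem quadConfig_dilate_congr {s t : ℝ} (hs : s ≠ 0) (ht : t ≠ 0) (h : s = t)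
    (S : QuadConfig (univ : Set ℂ)) : QuadConfig.dilate s hs S = QuadConfig.dilate t ht S := by
  subst h; rfl

/-- `S_{t⁻¹} (S_t S) = S`. [folklore] -/
@[simp] theorem quadConfig_dilate_inv_dilate (t : ℝ) (ht : t ≠ 0) (S : QuadConfig (univ : Set ℂ)) :
    QuadConfig.dilate t⁻¹ (inv_ne_zero ht) (QuadConfig.dilate t ht S) = S := by
  rw [quadConfig_dilate_dilate, quadConfig_dilate_congr _ one_ne_zero (inv_mul_cancel₀ ht),
    quadConfig_dilate_one]

/-- `S_t (S_{t⁻¹} S) = S`. [folklore] -/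
@[simp] theorem quadConfig_dilate_dilate_inv (t : ℝ) (ht : t ≠ 0) (S : QuadConfig (univ : Set ℂ)) :
    QuadConfig.dilate t ht (QuadConfig.dilate t⁻¹ (inv_ne_zero ht) S) = S := by
  rw [quadConfig_dilate_dilate, quadConfig_dilate_congr _ one_ne_zero (mul_inv_cancel₀ ht),
    quadConfig_dilate_one]

/-- `(g ·)⁻¹' V_U = V_{g⁻¹ U}` for any plane homeomorphism. [folklore] -/
theorem preimage_mapHomeomorph_someCrossed (g : ℂ ≃ₜ ℂ) (U : Set (Quad (univ : Set ℂ))) :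
    QuadConfig.mapHomeomorph g ⁻¹' QuadConfig.someCrossed U =
      QuadConfig.someCrossed (Quad.congrHomeomorph g ⁻¹' U) := by
  ext S
  simp only [mem_preimage, QuadConfig.someCrossed, mem_setOf_eq, QuadConfig.mapHomeomorph]
  exact Set.image_inter_nonempty_iff

/-- `(g ·)⁻¹' V^Q = V^{g⁻¹ Q}` for any plane homeomorphism. [folklore] -/
theorem preimage_mapHomeomorph_notCrossed (g : ℂ ≃ₜ ℂ) (Q : Quad (univ : Set ℂ)) :
    QuadConfig.mapHomeomorph g ⁻¹' QuadConfig.notCrossed Q =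
      QuadConfig.notCrossed (Q.mapHomeomorph g.symm) := by
  ext S
  simp only [mem_preimage, QuadConfig.notCrossed, mem_setOf_eq, QuadConfig.mem_mapHomeomorph]

/-- **`S ↦ g · S` is continuous** on `ℋ_ℂ` for every plane homeomorphism `g` (preimages of
subbasic sets are subbasic). [folklore] -/
theorem continuous_quadConfig_mapHomeomorph (g : ℂ ≃ₜ ℂ) :
    Continuous (QuadConfig.mapHomeomorph g : QuadConfig (univ : Set ℂ) → QuadConfig univ) := by
  refine continuous_generateFrom_iff.mpr ?_
  rintro V (⟨U, hU, rfl⟩ | ⟨Q, rfl⟩)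
  · rw [preimage_mapHomeomorph_someCrossed]
    exact QuadConfig.isOpen_someCrossed (hU.preimage (Quad.congrHomeomorph g).continuous)
  · rw [preimage_mapHomeomorph_notCrossed]
    exact QuadConfig.isOpen_notCrossed _

/-- `S ↦ S_t S` is continuous. [folklore] -/
theorem continuous_quadConfig_dilate (t : ℝ) (ht : t ≠ 0) :
    Continuous (QuadConfig.dilate t ht : QuadConfig (univ : Set ℂ) → QuadConfig univ) :=
  continuous_quadConfig_mapHomeomorph _

/-- `S ↦ S_t S` is Borel measurable. [folklore] -/
theorem measurable_quadConfig_dilate (t : ℝ) (ht : t ≠ 0) :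
    Measurable (QuadConfig.dilate t ht : QuadConfig (univ : Set ℂ) → QuadConfig univ) :=
  (continuous_quadConfig_dilate t ht).measurable

/-- `S_t⁻¹' ⊞_Q = ⊞_{S_{t⁻¹} Q}`. [folklore] -/
theorem preimage_dilate_crossedEvent (t : ℝ) (ht : t ≠ 0) (Q : Quad (univ : Set ℂ)) :
    QuadConfig.dilate t ht ⁻¹' QuadConfig.crossedEvent Q =
      QuadConfig.crossedEvent (Q.dilate t⁻¹ (inv_ne_zero ht)) := by
  ext S
  exact mem_quadConfig_dilate_iff t ht S Q

/-- The crossing pattern of a family of quads in a dilated configuration is the pattern of the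
inversely dilated family. [folklore] -/
theorem setOf_mem_dilate (t : ℝ) (ht : t ≠ 0) {n : ℕ} (Q : Fin n → Quad (univ : Set ℂ))
    (S : QuadConfig (univ : Set ℂ)) :
    {i | Q i ∈ QuadConfig.dilate t ht S} = {i | (Q i).dilate t⁻¹ (inv_ne_zero ht) ∈ S} := by
  ext i
  exact mem_quadConfig_dilate_iff t ht S (Q i)

/-- **Push-forward of crossing probabilities**: `(S_t)_* P (⊞_Q) = P (⊞_{S_{t⁻¹} Q})`. [folklore] -/
theorem map_dilate_apply_crossedEvent (P : Measure (QuadConfig (univ : Set ℂ))) (t : ℝ) (ht : t ≠ 0)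
    (Q : Quad (univ : Set ℂ)) :
    Measure.map (QuadConfig.dilate t ht) P (QuadConfig.crossedEvent Q) =
      P (QuadConfig.crossedEvent (Q.dilate t⁻¹ (inv_ne_zero ht))) := by
  rw [Measure.map_apply (measurable_quadConfig_dilate t ht) (QuadConfig.measurableSet_crossedEvent Q),
    preimage_dilate_crossedEvent]

/-- Real-valued form of `map_dilate_apply_crossedEvent`. [folklore] -/
theorem map_dilate_real_crossedEvent (P : Measure (QuadConfig (univ : Set ℂ))) (t : ℝ) (ht : t ≠ 0)
    (Q : Quad (univ : Set ℂ)) :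
    (Measure.map (QuadConfig.dilate t ht) P).real (QuadConfig.crossedEvent Q) =
      P.real (QuadConfig.crossedEvent (Q.dilate t⁻¹ (inv_ne_zero ht))) := by
  simp only [Measure.real, map_dilate_apply_crossedEvent]

/-- `(S_t)_* P` is a probability law when `P` is. [folklore] -/
theorem isProbabilityMeasure_map_dilate (P : Measure (QuadConfig (univ : Set ℂ))) [IsProbabilityMeasure P]
    (t : ℝ) (ht : t ≠ 0) : IsProbabilityMeasure (Measure.map (QuadConfig.dilate t ht) P) :=
  Measure.isProbabilityMeasure_map (measurable_quadConfig_dilate t ht).aemeasurable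

/-- `(S_{t⁻¹})_* (S_t)_* P = P`. [folklore] -/
theorem map_dilate_inv_map_dilate (P : Measure (QuadConfig (univ : Set ℂ))) (t : ℝ) (ht : t ≠ 0) :
    Measure.map (QuadConfig.dilate t⁻¹ (inv_ne_zero ht)) (Measure.map (QuadConfig.dilate t ht) P) = P := by
  rw [Measure.map_map (measurable_quadConfig_dilate _ _) (measurable_quadConfig_dilate t ht)]
  have : (QuadConfig.dilate t⁻¹ (inv_ne_zero ht) ∘ QuadConfig.dilate t ht :
      QuadConfig (univ : Set ℂ) → QuadConfig univ) = id :=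
    funext fun S => quadConfig_dilate_inv_dilate t ht S
  rw [this, Measure.map_id]

/-- `(S_t)_* (S_{t⁻¹})_* P = P`. [folklore] -/
theorem map_dilate_map_dilate_inv (P : Measure (QuadConfig (univ : Set ℂ))) (t : ℝ) (ht : t ≠ 0) :
    Measure.map (QuadConfig.dilate t ht) (Measure.map (QuadConfig.dilate t⁻¹ (inv_ne_zero ht)) P) = P := by
  rw [Measure.map_map (measurable_quadConfig_dilate t ht) (measurable_quadConfig_dilate _ _)]
  have : (QuadConfig.dilate t ht ∘ QuadConfig.dilate t⁻¹ (inv_ne_zero ht) :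
      QuadConfig (univ : Set ℂ) → QuadConfig univ) = id :=
    funext fun S => quadConfig_dilate_dilate_inv t ht S
  rw [this, Measure.map_id]

end Summit.CriticalPhenomena.CardyFormulaZ2.Theorems.CardyMeckeFlip

end
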